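import Mathlib
import Summits.Ventures.PercRepro.TriangleCapBlockWitness
import Summits.Ventures.PercRepro.TriangleCapNestedWitness

/-!
# PercRepro — THE STAR FAMILY: THE INDEX FUNCTIONS AND THEIR PHASES (p3, gen 56; part 315)

The witnesses of the residue minimum of part 312 (`band_ge_residue_min`) beyond the bipartite graphs: `a` SPECIAL
non-neighbours `1, …, a` joined by inside edges to one CENTRE `a + Q + 1` (part 317), `Q` REGULAR non-neighbours
`a + 1, …, a + Q`; the rows (leaves of `w`) are `Rc` CENTRE ROWS `ℓ + 1, …, ℓ + Rc` (each = the centre plus `D − 1`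
regular columns; the first one SHORT by `short`), `D − 1` OUTER ROWS `ℓ + Rc + 1, …, ℓ + Rc + D − 1` (each = every
special plus `D − a` regular columns) and `E` EXTRA ROWS (each = `D` regular columns).  The regular columns are
swept cyclically (`a + 1 + (p mod Q)`) through the regular slots of the rows in order — the rows are the blocks of
the cyclic block witness of part 288 (`rfMulti`, block sizes `kSF`): `lfSF` / `rfSF` on
`Rc + a (D − 1) + Q D` indices, in three phases (centre pairs, special pairs, regular pairs).  The classes: the
centre `Rc`, every special `D − 1`, every regular column `D` (`cls_lfSF_*`); the centre row `ℓ + 1 + ρ` has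
`D − [ρ = 0] short`, every outer and extra row `D` (`cls_rfSF_*`).  Axioms: standard.
-/

namespace PercRepro

namespace TriangleCap

namespace C047

open Finset

/-- **THE SPLIT OF A FILTERED RANGE:** `#{i < A + B : p i} = #{i < A : p i} + #{i < B : p (A + i)}`. -/
theorem card_filter_range_add (A B : ℕ) (p : ℕ → Prop) [DecidablePred p] :
    ((range (A + B)).filter p).card =
      ((range A).filter p).card + ((range B).filter (fun i => p (A + i))).card := by
  have hdisj : Disjoint ((range A).filter p) (((range B).map (addLeftEmbedding A)).filter p) := by
    rw [disjoint_left]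
    intro x hx hx'
    rw [mem_filter, mem_range] at hx
    rw [mem_filter, mem_map] at hx'
    obtain ⟨y, -, hy⟩ := hx'.1
    rw [addLeftEmbedding_apply] at hy
    omega
  rw [range_add_eq_union, filter_union, card_union_of_disjoint hdisj, filter_map, card_map]
  congr 1

/-- The regular-slot sizes of the rows: the short centre row `0` carries `D − 1 − short` regular columns, the other
centre rows `D − 1`, the `D − 1` outer rows `D − a`, the extra rows `D`. -/
def kSF (D a Rc short ρ : ℕ) : ℕ :=
  if ρ = 0 then D - 1 - short else if ρ < Rc then D - 1 else if ρ < Rc + (D - 1) then D - a else D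

/-- The left ends: the centre `a + Q + 1` on the centre pairs, the special `1 + ((i − Rc) mod a)` on the special
pairs, the regular column `a + 1 + (p mod Q)` at the regular position `p`. -/
def lfSF (D a Rc Q i : ℕ) : ℕ :=
  if i < Rc then a + Q + 1
  else if i < Rc + a * (D - 1) then 1 + (i - Rc) % a
  else a + 1 + (i - Rc - a * (D - 1)) % Q

/-- The right ends: the centre row `ℓ + 1 + i`, the outer row `ℓ + 1 + Rc + ⌊(i − Rc) / a⌋`, the block row of the
regular position. -/
def rfSF (ℓ D a Rc short E i : ℕ) : ℕ :=
  if i < Rc then ℓ + 1 + i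
  else if i < Rc + a * (D - 1) then ℓ + 1 + Rc + (i - Rc) / a
  else rfMulti ℓ (kSF D a Rc short) (Rc + (D - 1) + E) (i - Rc - a * (D - 1))

/-- The centre pairs. -/
theorem lfSF_phaseC (D a Rc Q i : ℕ) (hi : i < Rc) : lfSF D a Rc Q i = a + Q + 1 := by
  unfold lfSF
  rw [if_pos hi]

/-- The special pairs. -/
theorem lfSF_phaseS (D a Rc Q i : ℕ) (hi : i < a * (D - 1)) : lfSF D a Rc Q (Rc + i) = 1 + i % a := by
  unfold lfSF
  rw [if_neg (by omega), if_pos (by omega), Nat.add_sub_cancel_left]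

/-- The regular pairs. -/
theorem lfSF_phaseR (D a Rc Q i : ℕ) : lfSF D a Rc Q (Rc + a * (D - 1) + i) = a + 1 + i % Q := by
  unfold lfSF
  rw [if_neg (by omega), if_neg (by omega)]
  have : Rc + a * (D - 1) + i - Rc - a * (D - 1) = i := by omega
  rw [this]

/-- The centre rows. -/
theorem rfSF_phaseC (ℓ D a Rc short E i : ℕ) (hi : i < Rc) : rfSF ℓ D a Rc short E i = ℓ + 1 + i := by
  unfold rfSF
  rw [if_pos hi]

/-- The outer rows. -/
theorem rfSF_phaseS (ℓ D a Rc short E i : ℕ) (hi : i < a * (D - 1)) :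
    rfSF ℓ D a Rc short E (Rc + i) = ℓ + 1 + Rc + i / a := by
  unfold rfSF
  rw [if_neg (by omega), if_pos (by omega), Nat.add_sub_cancel_left]

/-- The block rows. -/
theorem rfSF_phaseR (ℓ D a Rc short E i : ℕ) :
    rfSF ℓ D a Rc short E (Rc + a * (D - 1) + i) = rfMulti ℓ (kSF D a Rc short) (Rc + (D - 1) + E) i := by
  unfold rfSF
  rw [if_neg (by omega), if_neg (by omega)]
  have : Rc + a * (D - 1) + i - Rc - a * (D - 1) = i := by omega
  rw [this]

/-- **THE BLOCK SUM:** the regular slots of all rows number `Q D` under the incidence identity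
`Rc (D − 1) + (D − 1)(D − a) + E D = Q D + short`. -/
theorem blockSum_kSF (D a Rc short E Q : ℕ) (hRc : 1 ≤ Rc) (hshort : short + 1 ≤ D)
    (hinc : Rc * (D - 1) + (D - 1) * (D - a) + E * D = Q * D + short) :
    blockSum (kSF D a Rc short) (Rc + (D - 1) + E) = Q * D := by
  unfold blockSum
  rw [range_eq_Ico, ← sum_Ico_consecutive _ (Nat.zero_le 1) (by omega : 1 ≤ Rc + (D - 1) + E),
    ← sum_Ico_consecutive _ (by omega : 1 ≤ Rc) (by omega : Rc ≤ Rc + (D - 1) + E),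
    ← sum_Ico_consecutive _ (by omega : Rc ≤ Rc + (D - 1)) (by omega : Rc + (D - 1) ≤ Rc + (D - 1) + E)]
  rw [sum_const_nat (m := D - 1 - short) (fun x hx => by
      rw [mem_Ico] at hx
      unfold kSF
      rw [if_pos (by omega)]),
    sum_const_nat (m := D - 1) (fun x hx => by
      rw [mem_Ico] at hx
      unfold kSF
      rw [if_neg (by omega), if_pos (by omega)]),
    sum_const_nat (m := D - a) (fun x hx => by
      rw [mem_Ico] at hx
      unfold kSF
      rw [if_neg (by omega), if_neg (by omega), if_pos (by omega)]),
    sum_const_nat (m := D) (fun x hx => by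
      rw [mem_Ico] at hx
      unfold kSF
      rw [if_neg (by omega), if_neg (by omega), if_neg (by omega)])]
  simp only [Nat.card_Ico]
  obtain ⟨R, rfl⟩ : ∃ R, Rc = R + 1 := ⟨Rc - 1, by omega⟩
  have e1 : R + 1 - 1 = R := by omega
  have e2 : R + 1 + (D - 1) - (R + 1) = D - 1 := by omega
  have e3 : R + 1 + (D - 1) + E - (R + 1 + (D - 1)) = E := by omega
  rw [e1, e2, e3, Nat.sub_zero, one_mul]
  have e4 : (R + 1) * (D - 1) = R * (D - 1) + (D - 1) := by ring
  rw [e4] at hinc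
  omega

/-- The block sizes are at most `Q`: `D − 1 ≤ Q`, and `D ≤ Q` when there are extra rows. -/
theorem kSF_le (D a Rc short E Q ρ : ℕ) (ha : 1 ≤ a) (hQ1 : D ≤ Q + 1) (hQE : 1 ≤ E → D ≤ Q)
    (hρ : ρ < Rc + (D - 1) + E) : kSF D a Rc short ρ ≤ Q := by
  unfold kSF
  split_ifs with h1 h2 h3
  · omega
  · omega
  · omega
  · exact hQE (by omega)

/-- The bounds of the left ends: `1 ≤ lfSF i ≤ a + Q + 1`. -/
theorem lfSF_bounds (D a Rc Q i : ℕ) (ha : 1 ≤ a) (hQ : 1 ≤ Q) :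
    1 ≤ lfSF D a Rc Q i ∧ lfSF D a Rc Q i ≤ a + Q + 1 := by
  unfold lfSF
  split_ifs
  · omega
  · have := Nat.mod_lt (i - Rc) (by omega : 0 < a)
    omega
  · have := Nat.mod_lt (i - Rc - a * (D - 1)) (by omega : 0 < Q)
    omega

/-- The left end is the centre iff the pair is a centre pair. -/
theorem lfSF_eq_centre_iff (D a Rc Q i : ℕ) (ha : 1 ≤ a) (hQ : 1 ≤ Q) :
    lfSF D a Rc Q i = a + Q + 1 ↔ i < Rc := by
  unfold lfSF
  split_ifs with h1 h2
  · exact ⟨fun _ => h1, fun _ => rfl⟩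
  · have := Nat.mod_lt (i - Rc) (by omega : 0 < a)
    exact ⟨fun h => by omega, fun h => absurd h h1⟩
  · have := Nat.mod_lt (i - Rc - a * (D - 1)) (by omega : 0 < Q)
    exact ⟨fun h => by omega, fun h => absurd h h1⟩

/-- The left end is a special iff the pair is a special pair. -/
theorem lfSF_le_iff (D a Rc Q i : ℕ) (ha : 1 ≤ a) (hQ : 1 ≤ Q) :
    lfSF D a Rc Q i ≤ a ↔ Rc ≤ i ∧ i < Rc + a * (D - 1) := by
  unfold lfSF
  split_ifs with h1 h2
  · exact ⟨fun h => by omega, fun h => by omega⟩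
  · have := Nat.mod_lt (i - Rc) (by omega : 0 < a)
    exact ⟨fun _ => ⟨by omega, h2⟩, fun _ => by omega⟩
  · have := Nat.mod_lt (i - Rc - a * (D - 1)) (by omega : 0 < Q)
    exact ⟨fun h => by omega, fun h => absurd h.2 h2⟩

/-- The bounds of the right ends: `ℓ + 1 ≤ rfSF i < ℓ + 1 + (Rc + (D − 1) + E)` on the index range. -/
theorem rfSF_bounds (ℓ D a Rc short E Q i : ℕ) (ha : 1 ≤ a) (hRc : 1 ≤ Rc) (hshort : short + 1 ≤ D)
    (hinc : Rc * (D - 1) + (D - 1) * (D - a) + E * D = Q * D + short) (hi : i < Rc + a * (D - 1) + Q * D) :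
    ℓ + 1 ≤ rfSF ℓ D a Rc short E i ∧ rfSF ℓ D a Rc short E i < ℓ + 1 + (Rc + (D - 1) + E) := by
  unfold rfSF
  split_ifs with h1 h2
  · omega
  · have hdiv : (i - Rc) / a < D - 1 := by
      rw [Nat.div_lt_iff_lt_mul (by omega)]
      have := Nat.mul_comm a (D - 1)
      omega
    have h0 := Nat.zero_le ((i - Rc) / a)
    refine ⟨by omega, ?_⟩
    calc ℓ + 1 + Rc + (i - Rc) / a < ℓ + 1 + Rc + (D - 1) := Nat.add_lt_add_left hdiv _
      _ ≤ ℓ + 1 + (Rc + (D - 1) + E) := by omega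
  · have hb := rfMulti_bounds ℓ (kSF D a Rc short) (Rc + (D - 1) + E) (i - Rc - a * (D - 1)) (by
      rw [blockSum_kSF D a Rc short E Q hRc hshort hinc]
      omega)
    exact hb

/-- The centre pairs lie on the centre rows. -/
theorem rfSF_of_centre (ℓ D a Rc short E i : ℕ) (hi : i < Rc) :
    rfSF ℓ D a Rc short E i < ℓ + 1 + Rc := by
  rw [rfSF_phaseC ℓ D a Rc short E i hi]
  omega

/-- The special pairs lie on the outer rows. -/
theorem rfSF_of_special (ℓ D a Rc short E i : ℕ) (hi1 : Rc ≤ i) (hi2 : i < Rc + a * (D - 1)) :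
    ℓ + 1 + Rc ≤ rfSF ℓ D a Rc short E i := by
  obtain ⟨i', rfl⟩ : ∃ i', i = Rc + i' := ⟨i - Rc, by omega⟩
  rw [rfSF_phaseS ℓ D a Rc short E i' (by omega)]
  exact Nat.le_add_right _ _

end C047

end TriangleCap

end PercRepro
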